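import Summits.MatrixMultiplication.OmegaCensus.STPP222IcosetRankThreeReduction
import Mathlib.Data.ZMod.Basic

/-!
# ω-census, icoset class negatives, KERNEL: no involution-coset `(2,2,2)⁶` family in `𝔽₂³ × ℤ₇`, `𝔽₂³ × ℤ₉`

HONEST FRAMING (pub-omega census; verbatim): lottery ticket; floor = certified bounds/negative ranges.
Census STRUCTURE bookkeeping (question Q7; CLASS-INTERNAL negatives — they say nothing about unrestricted `(2,2,2)⁶` families and
nothing about `ω`).  The cell's engine-grade class census (`HOME/pub-omega-eng2-g27/icoset/ICOSET-NOTE.md`, icoset3 / icoset3c,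
K = 6: ℤ₂³×ℤ₇ —, ℤ₂³×ℤ₃² NONE, ℤ₂³×ℤ₉ NONE, ℤ₂³×ℤ₁₁ NONE) is re-derived here IN THE KERNEL for the cyclic `|H| ≤ 9` cells (`ℤ₃²`: `STPP222IcosetClassNoneK6Z33.lean`): the
H-stage search `IcosetH.check` (recursor engine `STPP222IcosetHSearch.lean`, soundness `STPP222IcosetHSearchSound.lean`, reduction
`STPP222IcosetRankThreeReduction.lean`) evaluated by `decide +kernel` — 781 / 12 039 DFS nodes, no slot-consistent leaf (≈ 8 ms/node on the farm).
The `ℤ₁₁` cell (151 112 nodes) is evaluated in chunks in `STPP222IcosetClassNoneK6Z11*.lean`.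

Encodings (`IcosetH.Enc`): `ZMod n` by `ZMod.val` with `cyc n`; `ZMod 3 × ZMod 3` by `3·val₁ + val₂` with `z33`.  `V = ZMod 2 × ZMod 2 × ZMod 2`
has `finrank 3`.  Statements are about `Icoset.IsIcosetFamily` (every set a coset `{(x,a),(x+s,a)}` of an order-2 subgroup `⟨(s,0)⟩`, `s ≠ 0`;
for odd `|H|` these are all order-2 subgroups of `V × H`).
References: H. Cohn, R. Kleinberg, B. Szegedy, C. Umans, FOCS 2005 (arXiv:math/0511460), Def. 5.1.  Seat pub-omega-kernel-l4 (gen 19), 2026-08-27.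
-/

namespace Summit.MatrixMultiplication.OmegaCensus

open Literature.Computability.AlgebraicComplexity

namespace IcosetH

/-- `(a - b).val` in `ZMod n`. [folklore] -/
theorem val_sub_eq {n : ℕ} [NeZero n] (a b : ZMod n) : (a - b).val = (a.val + (n - b.val)) % n := by
  rw [sub_eq_add_neg, ZMod.val_add, ZMod.neg_val', Nat.add_mod_mod]

/-- `ZMod n` is correctly encoded by `ZMod.val` and the code arithmetic `cyc n`. [folklore] -/
noncomputable def encZMod (n : ℕ) [NeZero n] : Enc (ZMod n) (cyc n) where
  enc := ZMod.val
  inj := ZMod.val_injective n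
  enc_zero := ZMod.val_zero
  enc_lt := ZMod.val_lt
  addC_enc u v := by show (u.val + v.val) % n = (u + v).val; rw [ZMod.val_add]
  subC_enc u v := by show (u.val + (n - v.val)) % n = (u - v).val; rw [val_sub_eq]

/-- `ZMod 3 × ZMod 3` is correctly encoded by `3·val₁ + val₂` and the code arithmetic `z33`. [folklore] -/
noncomputable def encZ33 : Enc (ZMod 3 × ZMod 3) z33 where
  enc u := 3 * u.1.val + u.2.val
  inj u v h := by
    change 3 * u.1.val + u.2.val = 3 * v.1.val + v.2.val at h
    have h1 := ZMod.val_lt u.1; have h2 := ZMod.val_lt u.2; have h3 := ZMod.val_lt v.1; have h4 := ZMod.val_lt v.2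
    have e1 : u.1.val = v.1.val := by omega
    have e2 : u.2.val = v.2.val := by omega
    exact Prod.ext (ZMod.val_injective 3 e1) (ZMod.val_injective 3 e2)
  enc_zero := by simp
  enc_lt u := by have h1 := ZMod.val_lt u.1; have h2 := ZMod.val_lt u.2; show _ < 9; omega
  addC_enc u v := by
    show 3 * (((3 * u.1.val + u.2.val) / 3 + (3 * v.1.val + v.2.val) / 3) % 3) +
        ((3 * u.1.val + u.2.val) % 3 + (3 * v.1.val + v.2.val) % 3) % 3 = 3 * (u + v).1.val + (u + v).2.val
    rw [Prod.fst_add, Prod.snd_add, ZMod.val_add, ZMod.val_add]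
    have h2 := ZMod.val_lt u.2; have h4 := ZMod.val_lt v.2
    omega
  subC_enc u v := by
    show 3 * (((3 * u.1.val + u.2.val) / 3 + (3 - (3 * v.1.val + v.2.val) / 3)) % 3) +
        ((3 * u.1.val + u.2.val) % 3 + (3 - (3 * v.1.val + v.2.val) % 3)) % 3 = 3 * (u - v).1.val + (u - v).2.val
    rw [Prod.fst_sub, Prod.snd_sub, val_sub_eq, val_sub_eq]
    have h2 := ZMod.val_lt u.2; have h4 := ZMod.val_lt v.2; have h3 := ZMod.val_lt v.1
    omega

/-- `finrank_{𝔽₂} (𝔽₂ × 𝔽₂ × 𝔽₂) = 3`. [folklore] -/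
theorem finrank_F2_cube : Module.finrank (ZMod 2) (ZMod 2 × ZMod 2 × ZMod 2) = 3 := by
  simp [Module.finrank_prod, Module.finrank_self]

/-- Kernel evaluation: the H-stage search for `ℤ₇`, `K = 6` (781 nodes). -/
theorem check_cyc7_six : check (cyc 7) 6 = true := by decide +kernel

/-- Kernel evaluation: the H-stage search for `ℤ₉`, `K = 6` (12 039 nodes). -/
theorem check_cyc9_six : check (cyc 9) 6 = true := by decide +kernel

end IcosetH

/-- **`𝔽₂³ × ℤ₇` (order 56) has no involution-coset `(2,2,2)⁶` STPP family** — KERNEL (class-internal negative).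
[cite: CohnKleinbergSzegedyUmans2005, Def. 5.1] -/
theorem no_icoset_pow6_F2cube_zmod7 :
    ¬ ∃ A B C : Fin 6 → Finset ((ZMod 2 × ZMod 2 × ZMod 2) × ZMod 7), Icoset.IsIcosetFamily A B C ∧ IsSTPP A B C :=
  Icoset.not_exists_of_check IcosetH.finrank_F2_cube (IcosetH.encZMod 7) (by norm_num) IcosetH.check_cyc7_six

/-- **`𝔽₂³ × ℤ₉` (order 72) has no involution-coset `(2,2,2)⁶` STPP family** — KERNEL (class-internal negative; the unrestricted
cell ℤ₂³×ℤ₉ is INFEASIBLE at engine grade ×2, Pb148). [cite: CohnKleinbergSzegedyUmans2005, Def. 5.1] -/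
theorem no_icoset_pow6_F2cube_zmod9 :
    ¬ ∃ A B C : Fin 6 → Finset ((ZMod 2 × ZMod 2 × ZMod 2) × ZMod 9), Icoset.IsIcosetFamily A B C ∧ IsSTPP A B C :=
  Icoset.not_exists_of_check IcosetH.finrank_F2_cube (IcosetH.encZMod 9) (by norm_num) IcosetH.check_cyc9_six

end Summit.MatrixMultiplication.OmegaCensus
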